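import Summits.BirchSwinnertonDyer.BirchSwinnertonDyer.Theses.BiquadraticEisensteinDescent
import Summits.BirchSwinnertonDyer.Rank1Residual.X12.InertCoreManinFreeDeuringFree
import Summits.BirchSwinnertonDyer.Rank1Residual.X12.CMIsogenyInvariance
import Summits.BirchSwinnertonDyer.Rank1Residual.Additive.PotGoodOrdinary
import Literature.NumberTheory.EllipticCurves.ComplexMultiplicationNotSemistable
import Literature.NumberTheory.EllipticCurves.IsogenyIdProofs
import HarnessLib

set_option linter.dupNamespace false -- `Summit.BirchSwinnertonDyer.BirchSwinnertonDyer.Theorems.…` (summit = sub)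
set_option autoImplicit false

/-!
# Crux `ManinDatumSupercuspidalCMInert` (stmt-BirchSwinnertonDyer-20111, BED r605): its two registered
# stubs `stub_S5` / `stub_S7` and the crux itself, FROM the Teichmüller-twist-descent crux SCMU57
# `SupercuspidalOptimalManinUnitFiveSeven` (stmt-BirchSwinnertonDyer-22639) — a kernel-checked reduction

Route `BiquadraticEisensteinDescent` (cell `pub/bsd-wall`, width-prover seat `bsd-wall-cm-bed-w1` g0, D-0152 M1).

The SUPERCUSPIDAL Manin residual R₅₇ˢᶜ of the BED route (skeleton `9438078f4db0f16c…`, planner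
`bsd-wall-cm` g2, stubs `stub_S5` = the `j = 0` cells II/IV/IV*/II* at `p = 5`, `stub_S7` = the `j = 1728`
cells III/III* at `p = 7`) asks `p ∤ c(D)` for a lattice-optimal `X₀(N)`-datum `D` of a CM curve `W` of
analytic rank one with `p` inert in the CM field and bad. The route `TeichmullerTwistDescent` files the
class-wide statement SCMU57 (its crux #3, `Theses.TeichmullerTwistDescent.SupercuspidalOptimalManinUnitFiveSeven`,
item stmt-BirchSwinnertonDyer-22639, whose informal text records «contains the CM `j = 0` cell of BED
(stmt-BirchSwinnertonDyer-20111) at `p = 5`»): for `W/ℚ` globally minimal, `p ∈ {5,7}`, additive at `p` with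
`E[p]` irreducible, NO `ℚ`-isogenous curve (G)-ordinary at `p`, SOME `ℚ`-isogenous curve without an `Iₙ*`
fibre at `p`, and `D` lattice-optimal at any level: `p ∤ c(D)`.

This file proves, with the SCMU57 statement as an explicit hypothesis (VERBATIM the ledger signature of
stmt-BirchSwinnertonDyer-22639; no `Theses` module of another route is imported), that both BED stubs and
the BED crux follow. The four side hypotheses of SCMU57 are DISCHARGED in the CM-inert corner by tree
theorems:
* additive at `p`: bad (`¬ Good`) and never multiplicative for a CM curve (`Rank1Residual.not_mult_of_hasCM`,
  Silverman *AT* II.6.4);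
* `E[p]` irreducible: `p` odd and inert in the CM field (`X12.irr_of_cmInert`, Mazur 1978 Prop. 6.3);
* no isogenous curve is (G)-ordinary at `p`: CM and the CM field are `ℚ`-isogeny invariants
  (`X12.hasCM_of_isIsogenous`, `X12.cmInert_iff_of_isIsogenous`), and a CM curve at a non-split prime is not
  potentially good ordinary (Deuring, `X12.not_potentiallyGoodOrdinary_of_hasCM_of_not_cmSplit'`, the
  `hDeu`-free form resting on the tree theorem `deuring_not_hasUnitRootAt_of_hasCM_of_not_cmSplit_holds`);
* an isogenous curve without `Iₙ*` fibre at `p`: the curve itself (`IsIsogenous.refl_holds`), since the place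
  `v` of `ℤ` under `p` is unique (`Rat.HeightOneSpectrum.primesEquiv`) and its Kodaira symbol is one of
  II/IV/IV*/II* (resp. III/III*), none of which is an `Iₙ*`.
The analytic-rank and `j`-invariant binders of the stubs are idle.

* `stub_S5_of_scmu57` — the registered signature of `stub_S5` VERBATIM, behind the SCMU57 hypothesis.
* `stub_S7_of_scmu57` — the registered signature of `stub_S7` VERBATIM, behind the SCMU57 hypothesis.
* `maninDatumSupercuspidalCMInert_of_scmu57` — the ROUTE DECL `ManinDatumSupercuspidalCMInert` BY NAME, behind
  the SCMU57 hypothesis (both cells at once).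

HONEST STATUS. Nothing here closes stmt-BirchSwinnertonDyer-20111: SCMU57 is itself an OPEN crux (route
`TeichmullerTwistDescent` proves `SupercuspidalOptimalManinUnitFiveSevenOfCell : KatoNeronAndCremonaFacts →
PublishedInputsAdditiveKoly → SupersingularTorsionOptimalManinUnitFive → SupercuspidalOptimalManinUnitFiveSeven`,
so SCMU57 — hence R₅₇ˢᶜ — closes modulo two printed-input packages and the LOW Kosters–Pannekoek crux
stmt-BirchSwinnertonDyer-23884). Edixhoven 1991 Thm. 3 is typed in the tree at `7 < p` only
(`edixhoven_not_dvd_maninConstant_of_not_potentiallyGoodOrdinary`); at `p ∈ {5, 7}` the statement is a case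
of Manin's conjecture not in print. THEOREMS ONLY (no definition, no named fact, no `sorry`). BSD is not
proved by any of this.

References: [EdixhovenManin1991] Thm. 3; [Mazur1978] Prop. 6.3; [Lang1987] Ch. 13 §4 Thm. 12 (Deuring);
[SilvermanATAEC1994] Thm. II.6.4; [SilvermanAEC2009] III.4 Ex. 4.1, VII.5.1.
-/

noncomputable section

open scoped Classical

open WeierstrassCurve IsDedekindDomain NumberField
  Literature.NumberTheory.EllipticCurves Literature.NumberTheory.EllipticCurves.ModularForms
  Literature.NumberTheory.EllipticCurves.Rank1Residual
  Literature.NumberTheory.DiophantineGeometry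
  Summit.BirchSwinnertonDyer.Rank1Residual.Additive
  Summit.BirchSwinnertonDyer.Rank1Residual.X12

namespace Summit.BirchSwinnertonDyer.BirchSwinnertonDyer.Theorems.BiquadraticEisensteinDescentManinDatumSupercuspidalCMInertOfSCMU

open Summit.BirchSwinnertonDyer.BirchSwinnertonDyer.Theses.BiquadraticEisensteinDescent

/-! ## §1 The CM-inert corner satisfies the side hypotheses of SCMU57 -/

/-- Two places of `ℤ` with the same residue characteristic are equal (`Rat.HeightOneSpectrum.primesEquiv`
is a bijection onto the rational primes with first component `natGenerator`). [folklore] -/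
theorem heightOneSpectrum_int_eq_of_natGenerator_eq {v w : HeightOneSpectrum ℤ}
    (h : Rat.HeightOneSpectrum.natGenerator v = Rat.HeightOneSpectrum.natGenerator w) : v = w :=
  (Rat.HeightOneSpectrum.primesEquiv (R := ℤ)).injective (Subtype.ext h)

/-- **No `ℚ`-isogenous curve of a CM curve with `p` inert in the CM field is (G)-ordinary at `p`.** CM and
the CM field are isogeny invariants; at a non-split prime a CM curve is potentially supersingular (Deuring),
so over no subfield of `ℚ(ζ_p)` does it acquire good reduction with the unit-root condition above `p`.
[cite: Lang1987, Ch. 13 §4 Thm. 12] [cite: SilvermanAEC2009, Thm. III.6.1(a) and Cor. III.9.4] -/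
theorem not_typeGOrd_of_isIsogenous_of_hasCM_of_cmInert {W W' : WeierstrassCurve ℚ} [W.IsElliptic]
    [W'.IsElliptic] (h : IsIsogenous W W') (hCM : W.HasCM) {p : ℕ} [Fact p.Prime] (hin : CMInert W p) :
    ¬ TypeGOrd W' p :=
  not_potentiallyGoodOrdinary_of_hasCM_of_not_cmSplit' W' (hasCM_of_isIsogenous h hCM) p
    ((cmInert_iff_of_isIsogenous h hCM p).mp hin).2

/-- **A curve whose fibre at the place `v` over `p` is of type II, IV, IV* or II* has no `Iₙ*` fibre at any
place over `p`** (the place over `p` is unique). [cite: SilvermanAEC2009, VII.5.1 and Table 15.1 (App. C)] -/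
theorem kodairaSymbolAt_ne_Istar_of_sextic {W : WeierstrassCurve ℚ} {v : HeightOneSpectrum ℤ} {p : ℕ}
    (hv : Rat.HeightOneSpectrum.natGenerator v = p)
    (hk : W.kodairaSymbolAt v = .II ∨ W.kodairaSymbolAt v = .IV ∨ W.kodairaSymbolAt v = .IVstar ∨
      W.kodairaSymbolAt v = .IIstar) :
    ∀ (v' : HeightOneSpectrum ℤ) (n : ℕ), Rat.HeightOneSpectrum.natGenerator v' = p →
      W.kodairaSymbolAt v' ≠ KodairaSymbol.Istar n := by
  intro v' n hv' hI
  obtain rfl : v' = v := heightOneSpectrum_int_eq_of_natGenerator_eq (hv'.trans hv.symm)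
  rcases hk with h | h | h | h <;> rw [h] at hI <;> cases hI

/-- **A curve whose fibre at the place `v` over `p` is of type III or III* has no `Iₙ*` fibre at any place
over `p`** (the place over `p` is unique). [cite: SilvermanAEC2009, VII.5.1 and Table 15.1 (App. C)] -/
theorem kodairaSymbolAt_ne_Istar_of_quartic {W : WeierstrassCurve ℚ} {v : HeightOneSpectrum ℤ} {p : ℕ}
    (hv : Rat.HeightOneSpectrum.natGenerator v = p)
    (hk : W.kodairaSymbolAt v = .III ∨ W.kodairaSymbolAt v = .IIIstar) :
    ∀ (v' : HeightOneSpectrum ℤ) (n : ℕ), Rat.HeightOneSpectrum.natGenerator v' = p →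
      W.kodairaSymbolAt v' ≠ KodairaSymbol.Istar n := by
  intro v' n hv' hI
  obtain rfl : v' = v := heightOneSpectrum_int_eq_of_natGenerator_eq (hv'.trans hv.symm)
  rcases hk with h | h <;> rw [h] at hI <;> cases hI

/-- **The CM-inert additive corner meets every side hypothesis of SCMU57, so SCMU57 gives `p ∤ c(D)` there.**
For `W/ℚ` globally minimal with CM, `p` odd, inert in the CM field and bad, some place `v` over `p` with no
`Iₙ*`-type fibre over `p`, and a lattice-optimal datum `D` at any level `N`: the SCMU57 statement (hypothesis
`hSC`, verbatim the signature of stmt-BirchSwinnertonDyer-22639) yields `¬ p ∣ c(D)`. Additivity: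
`not_mult_of_hasCM`; irreducibility: `irr_of_cmInert`; (G)-ordinary exclusion along the isogeny class:
`not_typeGOrd_of_isIsogenous_of_hasCM_of_cmInert`; the `Iₙ*`-free isogenous curve is `W` itself.
[cite: SilvermanATAEC1994, Thm. II.6.4] [cite: Mazur1978, §6 Prop. 6.3 (1)] [cite: Lang1987, Ch. 13 §4 Thm. 12] -/
theorem not_dvd_c_of_scmu57_of_hasCM_of_cmInert
    (hSC : ∀ (W : WeierstrassCurve ℚ) [W.IsElliptic] [W.IsGloballyMinimal] (p : ℕ) [Fact p.Prime] (N : ℕ)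
      [NeZero N] (D : ModularParametrizationData W N), (p = 5 ∨ p = 7) → Addv W p → Irr W p →
      (∀ (W' : WeierstrassCurve ℚ) [W'.IsElliptic] [W'.IsGloballyMinimal], IsIsogenous W W' → ¬ TypeGOrd W' p) →
      (∃ (W' : WeierstrassCurve ℚ) (_ : W'.IsElliptic) (_ : W'.IsGloballyMinimal), IsIsogenous W W' ∧
        ∀ (v : HeightOneSpectrum ℤ) (n : ℕ), Rat.HeightOneSpectrum.natGenerator v = p →
          W'.kodairaSymbolAt v ≠ KodairaSymbol.Istar n) →
      (∀ z ∈ D.L.lattice, ∃ w ∈ periodLattice D.f, z = D.c * w) → ¬ (p : ℤ) ∣ D.c)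
    (W : WeierstrassCurve ℚ) [W.IsElliptic] [W.IsGloballyMinimal] (p : ℕ) [Fact p.Prime] (N : ℕ) [NeZero N]
    (D : ModularParametrizationData W N) (hp57 : p = 5 ∨ p = 7) (hCM : W.HasCM) (hin : CMInert W p)
    (hbad : ¬ Good W p)
    (hI : ∀ (v : HeightOneSpectrum ℤ) (n : ℕ), Rat.HeightOneSpectrum.natGenerator v = p →
      W.kodairaSymbolAt v ≠ KodairaSymbol.Istar n)
    (hopt : ∀ z ∈ D.L.lattice, ∃ w ∈ periodLattice D.f, z = D.c * w) :
    ¬ (p : ℤ) ∣ D.c := by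
  have hp2 : p ≠ 2 := by omega
  have hadd : Addv W p := ⟨hbad, not_mult_of_hasCM W hCM p⟩
  have hirr : Irr W p := irr_of_cmInert W p hp2 hin
  have hG : ∀ (W' : WeierstrassCurve ℚ) [W'.IsElliptic] [W'.IsGloballyMinimal],
      IsIsogenous W W' → ¬ TypeGOrd W' p :=
    fun W' _ _ hiso ↦ not_typeGOrd_of_isIsogenous_of_hasCM_of_cmInert hiso hCM hin
  have hrefl : IsIsogenous W W := IsIsogenous.refl_holds W
  exact hSC W p N D hp57 hadd hirr hG ⟨W, ‹_›, ‹_›, hrefl, hI⟩ hopt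

/-! ## §2 The registered stubs `stub_S5`, `stub_S7` and the crux, behind SCMU57 -/

/-- **Stub `stub_S5` of skeleton `9438078f…` (crux `ManinDatumSupercuspidalCMInert`, BED r605), GIVEN SCMU57** —
the registered signature verbatim: for `W/ℚ` globally minimal CM of analytic rank one, `p = 5`, `j(W) = 0`,
`5` inert in the CM field and bad, `D` a lattice-optimal `X₀(N_W)`-datum, and the place `v` over `5` of
Kodaira type II, IV, IV* or II*: `5 ∤ c(D)`. The analytic-rank and `j` binders are idle.
[cite: EdixhovenManin1991, Thm. 3 (the statement's shape; p ∈ {5,7} is NOT covered in print)]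
[cite: Lang1987, Ch. 13 §4 Thm. 12] [cite: Mazur1978, §6 Prop. 6.3 (1)] -/
theorem stub_S5_of_scmu57
    (hSC : ∀ (W : WeierstrassCurve ℚ) [W.IsElliptic] [W.IsGloballyMinimal] (p : ℕ) [Fact p.Prime] (N : ℕ)
      [NeZero N] (D : ModularParametrizationData W N), (p = 5 ∨ p = 7) → Addv W p → Irr W p →
      (∀ (W' : WeierstrassCurve ℚ) [W'.IsElliptic] [W'.IsGloballyMinimal], IsIsogenous W W' → ¬ TypeGOrd W' p) →
      (∃ (W' : WeierstrassCurve ℚ) (_ : W'.IsElliptic) (_ : W'.IsGloballyMinimal), IsIsogenous W W' ∧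
        ∀ (v : HeightOneSpectrum ℤ) (n : ℕ), Rat.HeightOneSpectrum.natGenerator v = p →
          W'.kodairaSymbolAt v ≠ KodairaSymbol.Istar n) →
      (∀ z ∈ D.L.lattice, ∃ w ∈ periodLattice D.f, z = D.c * w) → ¬ (p : ℤ) ∣ D.c) :
    ∀ (W : WeierstrassCurve ℚ) [W.IsElliptic] [W.IsGloballyMinimal] [NeZero (W.conductorNorm ℤ)] (p : ℕ)
      [Fact p.Prime] (D : ModularParametrizationData W (W.conductorNorm ℤ)) (v : IsDedekindDomain.HeightOneSpectrum ℤ),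
      Rat.HeightOneSpectrum.natGenerator v = p → W.HasCM → W.analyticRank = 1 → p = 5 → W.j = 0 →
      CMInert W p → ¬ Good W p → (∀ z ∈ D.L.lattice, ∃ w ∈ periodLattice D.f, z = D.c * w) →
      (W.kodairaSymbolAt v = .II ∨ W.kodairaSymbolAt v = .IV ∨ W.kodairaSymbolAt v = .IVstar ∨
        W.kodairaSymbolAt v = .IIstar) → ¬ (p : ℤ) ∣ D.c := by
  intro W _ _ _ p _ D v hv hCM _hr hp5 _hj hin hbad hopt hk
  exact not_dvd_c_of_scmu57_of_hasCM_of_cmInert hSC W p (W.conductorNorm ℤ) D (Or.inl hp5) hCM hin hbad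
    (kodairaSymbolAt_ne_Istar_of_sextic hv hk) hopt

/-- **Stub `stub_S7` of skeleton `9438078f…` (crux `ManinDatumSupercuspidalCMInert`, BED r605), GIVEN SCMU57** —
the registered signature verbatim: for `W/ℚ` globally minimal CM of analytic rank one, `p = 7`,
`j(W) = 1728`, `7` inert in the CM field and bad, `D` a lattice-optimal `X₀(N_W)`-datum, and the place `v` over
`7` of Kodaira type III or III*: `7 ∤ c(D)`. The analytic-rank and `j` binders are idle.
[cite: EdixhovenManin1991, Thm. 3 (the statement's shape; p ∈ {5,7} is NOT covered in print)]
[cite: Lang1987, Ch. 13 §4 Thm. 12] [cite: Mazur1978, §6 Prop. 6.3 (1)] -/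
theorem stub_S7_of_scmu57
    (hSC : ∀ (W : WeierstrassCurve ℚ) [W.IsElliptic] [W.IsGloballyMinimal] (p : ℕ) [Fact p.Prime] (N : ℕ)
      [NeZero N] (D : ModularParametrizationData W N), (p = 5 ∨ p = 7) → Addv W p → Irr W p →
      (∀ (W' : WeierstrassCurve ℚ) [W'.IsElliptic] [W'.IsGloballyMinimal], IsIsogenous W W' → ¬ TypeGOrd W' p) →
      (∃ (W' : WeierstrassCurve ℚ) (_ : W'.IsElliptic) (_ : W'.IsGloballyMinimal), IsIsogenous W W' ∧
        ∀ (v : HeightOneSpectrum ℤ) (n : ℕ), Rat.HeightOneSpectrum.natGenerator v = p →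
          W'.kodairaSymbolAt v ≠ KodairaSymbol.Istar n) →
      (∀ z ∈ D.L.lattice, ∃ w ∈ periodLattice D.f, z = D.c * w) → ¬ (p : ℤ) ∣ D.c) :
    ∀ (W : WeierstrassCurve ℚ) [W.IsElliptic] [W.IsGloballyMinimal] [NeZero (W.conductorNorm ℤ)] (p : ℕ)
      [Fact p.Prime] (D : ModularParametrizationData W (W.conductorNorm ℤ)) (v : IsDedekindDomain.HeightOneSpectrum ℤ),
      Rat.HeightOneSpectrum.natGenerator v = p → W.HasCM → W.analyticRank = 1 → p = 7 → W.j = 1728 →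
      CMInert W p → ¬ Good W p → (∀ z ∈ D.L.lattice, ∃ w ∈ periodLattice D.f, z = D.c * w) →
      (W.kodairaSymbolAt v = .III ∨ W.kodairaSymbolAt v = .IIIstar) → ¬ (p : ℤ) ∣ D.c := by
  intro W _ _ _ p _ D v hv hCM _hr hp7 _hj hin hbad hopt hk
  exact not_dvd_c_of_scmu57_of_hasCM_of_cmInert hSC W p (W.conductorNorm ℤ) D (Or.inr hp7) hCM hin hbad
    (kodairaSymbolAt_ne_Istar_of_quartic hv hk) hopt

/-- **The crux `ManinDatumSupercuspidalCMInert` (stmt-BirchSwinnertonDyer-20111) — THE ROUTE DECL BY NAME —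
GIVEN SCMU57** (`Theses.TeichmullerTwistDescent.SupercuspidalOptimalManinUnitFiveSeven`,
stmt-BirchSwinnertonDyer-22639, taken verbatim as the hypothesis `hSC`): both cells at once. A CONDITIONAL
closer; the crux stays open exactly as long as SCMU57 does (which the TTD route reduces to its printed-input
packages and the LOW crux stmt-BirchSwinnertonDyer-23884). BSD is not proved by any of this.
[cite: EdixhovenManin1991, Thm. 3 (the statement's shape; p ∈ {5,7} is NOT covered in print)]
[cite: Lang1987, Ch. 13 §4 Thm. 12] [cite: Mazur1978, §6 Prop. 6.3 (1)] [cite: SilvermanATAEC1994, Thm. II.6.4] -/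
theorem maninDatumSupercuspidalCMInert_of_scmu57
    (hSC : ∀ (W : WeierstrassCurve ℚ) [W.IsElliptic] [W.IsGloballyMinimal] (p : ℕ) [Fact p.Prime] (N : ℕ)
      [NeZero N] (D : ModularParametrizationData W N), (p = 5 ∨ p = 7) → Addv W p → Irr W p →
      (∀ (W' : WeierstrassCurve ℚ) [W'.IsElliptic] [W'.IsGloballyMinimal], IsIsogenous W W' → ¬ TypeGOrd W' p) →
      (∃ (W' : WeierstrassCurve ℚ) (_ : W'.IsElliptic) (_ : W'.IsGloballyMinimal), IsIsogenous W W' ∧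
        ∀ (v : HeightOneSpectrum ℤ) (n : ℕ), Rat.HeightOneSpectrum.natGenerator v = p →
          W'.kodairaSymbolAt v ≠ KodairaSymbol.Istar n) →
      (∀ z ∈ D.L.lattice, ∃ w ∈ periodLattice D.f, z = D.c * w) → ¬ (p : ℤ) ∣ D.c) :
    ManinDatumSupercuspidalCMInert := by
  intro W _ _ _ p _ D v hv hCM hr _hp57 hin hbad hopt hcell
  -- composition of the registered skeleton `9438078f…`: the two cells are the two stubs
  rcases hcell with ⟨hp5, hj, hk⟩ | ⟨hp7, hj, hk⟩
  · exact stub_S5_of_scmu57 hSC W p D v hv hCM hr hp5 hj hin hbad hopt hk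
  · exact stub_S7_of_scmu57 hSC W p D v hv hCM hr hp7 hj hin hbad hopt hk

end Summit.BirchSwinnertonDyer.BirchSwinnertonDyer.Theorems.BiquadraticEisensteinDescentManinDatumSupercuspidalCMInertOfSCMU

end
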